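import Summits.QuantumFields.YangMills.Theorems.PencilRigidityHypercubicLimitDefs
import Summits.QuantumFields.YangMills.Theorems.LangevinControlUVOSLegsFromFemtoAndGapStubAssemblySoftLegs
import Summits.QuantumFields.YangMills.Theorems.LangevinControlUVOSLegsFromFemtoAndGapStubAssemblyPlaneExpansion
import Literature.MathematicalPhysics.QuantumFieldTheory.SchwingerLimitInheritance
import HarnessLib

/-!
# Crux `HypercubicLimit` (stmt-QuantumFields-8646), line `conditional-mean-telescoping`: sub-goal `oneFieldFromPlanes`

Support file (`--supports stmt-QuantumFields-8646`, c2 seat; leg (S) `stub_softLegs` of the closure, reshape 3): the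
ONE-FIELD family assembled from plane-string functionals.  Given continuous linear functionals `Spl n q` (every arity,
every orientation string) with the bound `‖Spl n q F‖ ≤ (K n^γ)ⁿ ‖F‖_{s n}` and the exact E3 identity
`Spl n q (F^π) = Spl n (q ∘ π) F` on `⁰𝒮`, the family `S₁ 0 = δ`, `S₁ 1 = 0`, `S₁ n = Σ_{q increasing} Spl n q`
(`n ≥ 2`) is a one-field Schwinger family with E0 (normalisation), E0′ (`HasLinearGrowth`, constants
`α = exp((6K+1)e^γ)`, `β = γ+1`), E3, and the bound `‖S₁ n F‖ ≤ (6K n^γ + 1)ⁿ ‖F‖_{s n}` — the algebraic half of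
the `SoftData` bookkeeping of the line's vocabulary file (the plane expansion holds by definition).  Pure functional
bookkeeping; no lattice object enters.
Refs: OsterwalderSchrader1975 §2 (E0′, `⁰𝒮`).
-/

set_option autoImplicit false

noncomputable section

open scoped SchwartzMap BigOperators
open MeasureTheory Filter Topology
open Literature.MathematicalPhysics.QuantumFieldTheory Literature.MathematicalPhysics.QuantumLattice
open Literature.MathematicalPhysics.AQFT
open Summit.QuantumFields.YangMills.Theorems.OSLegsFromFemtoAndGap (pow_le_exp_mul_factorial card_planes)

namespace Summit.QuantumFields.YangMills.Cruxes.HypercubicLimit.ConditionalMeanTelescoping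

/-! ### Small facts -/

/-- `n^{γ n} ≤ e^{γ n} (n!)^γ` (from `nⁿ/n! ≤ eⁿ`). -/
theorem pow_pow_le_exp_mul_factorial_pow (n γ : ℕ) :
    ((n : ℝ) ^ γ) ^ n ≤ Real.exp (γ * n) * ((n.factorial : ℝ) ^ γ) := by
  have h := Real.pow_div_factorial_le_exp (x := (n : ℝ)) (Nat.cast_nonneg n) n
  rw [div_le_iff₀ (by positivity)] at h
  calc ((n : ℝ) ^ γ) ^ n = ((n : ℝ) ^ n) ^ γ := by rw [← pow_mul, ← pow_mul, mul_comm]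
    _ ≤ (Real.exp n * (n.factorial : ℝ)) ^ γ := pow_le_pow_left₀ (by positivity) h γ
    _ = Real.exp (γ * n) * ((n.factorial : ℝ) ^ γ) := by rw [mul_pow, ← Real.exp_nat_mul]

/-- The E0′ constants: `(6K n^γ + 1)ⁿ ≤ exp((6K+1)e^γ) · (n!)^{γ+1}` for `K ≥ 0`. -/
theorem linearGrowth_constant_le {K : ℝ} (hK : 0 ≤ K) (γ n : ℕ) :
    (6 * K * (n : ℝ) ^ γ + 1) ^ n ≤
      Real.exp ((6 * K + 1) * Real.exp γ) * (n.factorial : ℝ) ^ (((γ + 1 : ℕ) : ℝ)) := by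
  rw [Real.rpow_natCast]
  rcases Nat.eq_zero_or_pos n with rfl | hn
  · simp [Real.one_le_exp_iff]; positivity
  have hnγ : (1 : ℝ) ≤ (n : ℝ) ^ γ := one_le_pow₀ (by exact_mod_cast hn)
  have h1 : 6 * K * (n : ℝ) ^ γ + 1 ≤ (6 * K + 1) * (n : ℝ) ^ γ := by nlinarith
  have h2 : ((6 * K + 1) * (n : ℝ) ^ γ) ^ n ≤ (6 * K + 1) ^ n * (Real.exp (γ * n) * (n.factorial : ℝ) ^ γ) := by
    rw [mul_pow]
    exact mul_le_mul_of_nonneg_left (pow_pow_le_exp_mul_factorial_pow n γ) (by positivity)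
  have h3 : (6 * K + 1) ^ n * Real.exp (γ * n) ≤ Real.exp ((6 * K + 1) * Real.exp γ) * (n.factorial : ℝ) := by
    have : (6 * K + 1) ^ n * Real.exp (γ * n) = ((6 * K + 1) * Real.exp γ) ^ n := by
      rw [mul_pow, ← Real.exp_nat_mul, mul_comm (n : ℝ)]
    rw [this]
    exact pow_le_exp_mul_factorial (by positivity) n
  calc (6 * K * (n : ℝ) ^ γ + 1) ^ n ≤ ((6 * K + 1) * (n : ℝ) ^ γ) ^ n := pow_le_pow_left₀ (by positivity) h1 n
    _ ≤ (6 * K + 1) ^ n * (Real.exp (γ * n) * (n.factorial : ℝ) ^ γ) := h2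
    _ = ((6 * K + 1) ^ n * Real.exp (γ * n)) * (n.factorial : ℝ) ^ γ := by ring
    _ ≤ (Real.exp ((6 * K + 1) * Real.exp γ) * (n.factorial : ℝ)) * (n.factorial : ℝ) ^ γ :=
        mul_le_mul_of_nonneg_right h3 (by positivity)
    _ = Real.exp ((6 * K + 1) * Real.exp γ) * (n.factorial : ℝ) ^ (γ + 1) := by ring

/-! ### The registered sub-goal -/

/-- **`oneFieldFromPlanes`** (registered sub-goal of crux stmt-QuantumFields-8646, c2 seat): the one-field family from
plane-string functionals — see the module docstring. -/
theorem oneFieldFromPlanes :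
    ∀ (Spl : (n : ℕ) → (Fin n → Fin 4 × Fin 4) → (𝓢((Fin n → EuclideanSpace ℝ (Fin 4)), ℂ) →L[ℂ] ℂ))
      (K : ℝ) (γ s : ℕ), 0 ≤ K →
      (∀ (n : ℕ) (q : Fin n → Fin 4 × Fin 4) (F : 𝓢((Fin n → EuclideanSpace ℝ (Fin 4)), ℂ)),
        ‖Spl n q F‖ ≤ (K * (n : ℝ) ^ γ) ^ n * schwartzNorm (s * n) F) →
      (∀ (n : ℕ) (q : Fin n → Fin 4 × Fin 4) (π : Equiv.Perm (Fin n))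
        (F : 𝓢((Fin n → EuclideanSpace ℝ (Fin 4)), ℂ)), IsOffDiagonal F →
          Spl n q (permTest π F) = Spl n (q ∘ π) F) →
      ∃ S₁ : SchwingerFamily (EuclideanSpace ℝ (Fin 4)),
        (∀ F : 𝓢((Fin 0 → EuclideanSpace ℝ (Fin 4)), ℂ), S₁ 0 F = F default) ∧
        (∀ F : 𝓢((Fin 1 → EuclideanSpace ℝ (Fin 4)), ℂ), S₁ 1 F = 0) ∧
        (∀ n : ℕ, 2 ≤ n → ∀ F : 𝓢((Fin n → EuclideanSpace ℝ (Fin 4)), ℂ),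
          S₁ n F = ∑ q ∈ Fintype.piFinset (fun _ : Fin n => Finset.univ.filter fun p : Fin 4 × Fin 4 => p.1 < p.2),
            Spl n q F) ∧
        (∀ (n : ℕ) (F : 𝓢((Fin n → EuclideanSpace ℝ (Fin 4)), ℂ)),
          ‖S₁ n F‖ ≤ (6 * K * (n : ℝ) ^ γ + 1) ^ n * schwartzNorm (s * n) F) ∧
        S₁.toLabelled.IsNormalized ∧ S₁.toLabelled.HasLinearGrowth ∧ S₁.toLabelled.IsSymmetric := by
  intro Spl K γ s hK hbd hE3
  classical
  -- the family
  let S₁ : SchwingerFamily (EuclideanSpace ℝ (Fin 4)) := fun n =>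
    match n with
    | 0 => LabelledSchwingerFamily.evalAt default
    | 1 => 0
    | (m + 2) => ∑ q ∈ Fintype.piFinset (fun _ : Fin (m + 2) => Finset.univ.filter fun p : Fin 4 × Fin 4 => p.1 < p.2),
        Spl (m + 2) q
  have h0 : ∀ F : 𝓢((Fin 0 → EuclideanSpace ℝ (Fin 4)), ℂ), S₁ 0 F = F default := fun F =>
    LabelledSchwingerFamily.evalAt_apply _ _
  have h1 : ∀ F : 𝓢((Fin 1 → EuclideanSpace ℝ (Fin 4)), ℂ), S₁ 1 F = 0 := fun F => rfl
  have h2 : ∀ n : ℕ, 2 ≤ n → ∀ F : 𝓢((Fin n → EuclideanSpace ℝ (Fin 4)), ℂ),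
      S₁ n F = ∑ q ∈ Fintype.piFinset (fun _ : Fin n => Finset.univ.filter fun p : Fin 4 × Fin 4 => p.1 < p.2),
        Spl n q F := by
    intro n hn F
    obtain ⟨m, rfl⟩ : ∃ m, n = m + 2 := ⟨n - 2, by omega⟩
    change (∑ q ∈ Fintype.piFinset (fun _ : Fin (m + 2) => Finset.univ.filter fun p : Fin 4 × Fin 4 => p.1 < p.2),
        Spl (m + 2) q) F = _
    rw [FunLike.coe_sum, Finset.sum_apply]
  -- the bound
  have hbound : ∀ (n : ℕ) (F : 𝓢((Fin n → EuclideanSpace ℝ (Fin 4)), ℂ)),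
      ‖S₁ n F‖ ≤ (6 * K * (n : ℝ) ^ γ + 1) ^ n * schwartzNorm (s * n) F := by
    intro n F
    rcases Nat.lt_or_ge n 2 with hn | hn
    · interval_cases n
      · rw [h0, pow_zero, one_mul]
        simpa using norm_le_schwartzNorm (s * 0) F default
      · rw [h1, norm_zero]; exact mul_nonneg (by positivity) (schwartzNorm_nonneg _ _)
    · rw [h2 n hn]
      have hcard : (Fintype.piFinset (fun _ : Fin n => Finset.univ.filter fun p : Fin 4 × Fin 4 => p.1 < p.2)).card
          = 6 ^ n := by
        rw [Fintype.card_piFinset, Finset.prod_const, Finset.card_univ, Fintype.card_fin, card_planes]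
      calc ‖∑ q ∈ Fintype.piFinset (fun _ : Fin n => Finset.univ.filter fun p : Fin 4 × Fin 4 => p.1 < p.2), Spl n q F‖
          ≤ ∑ q ∈ Fintype.piFinset (fun _ : Fin n => Finset.univ.filter fun p : Fin 4 × Fin 4 => p.1 < p.2),
              (K * (n : ℝ) ^ γ) ^ n * schwartzNorm (s * n) F := norm_sum_le_of_le _ fun q _ => hbd n q F
        _ = 6 ^ n * ((K * (n : ℝ) ^ γ) ^ n * schwartzNorm (s * n) F) := by
            rw [Finset.sum_const, nsmul_eq_mul, hcard]; push_cast; ring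
        _ = (6 * K * (n : ℝ) ^ γ) ^ n * schwartzNorm (s * n) F := by rw [mul_pow, mul_pow, mul_pow]; ring
        _ ≤ (6 * K * (n : ℝ) ^ γ + 1) ^ n * schwartzNorm (s * n) F := by
            gcongr
            · exact schwartzNorm_nonneg _ _
            · linarith
  -- E3
  have hE3S : S₁.toLabelled.IsSymmetric := by
    intro n k π F hF
    simp only [SchwingerFamily.toLabelled_apply]
    rcases Nat.lt_or_ge n 2 with hn | hn
    · interval_cases n
      · rw [h0, h0, permTest_apply]
        exact congrArg F (Subsingleton.elim _ _)
      · rw [h1, h1]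
    · rw [h2 n hn, h2 n hn]
      simp_rw [hE3 n _ π F hF]
      -- reindex the sum over increasing strings by `q ↦ q ∘ π`
      refine Finset.sum_bij' (fun q _ => q ∘ π) (fun q _ => q ∘ π.symm) (fun q hq => ?_) (fun q hq => ?_)
        (fun q _ => ?_) (fun q _ => ?_) (fun q _ => rfl)
      · simp only [Fintype.mem_piFinset, Function.comp_apply] at hq ⊢
        exact fun i => hq _
      · simp only [Fintype.mem_piFinset, Function.comp_apply] at hq ⊢
        exact fun i => hq _
      · funext i; simp
      · funext i; simp
  refine ⟨S₁, fun F => (h0 F).trans (congrArg F (Subsingleton.elim _ _)), h1, h2, hbound,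
    fun k F => (h0 F).trans (congrArg F (Subsingleton.elim _ _)), ?_, hE3S⟩
  -- E0′
  refine hasLinearGrowth_of_norm_le S₁ s (Real.exp ((6 * K + 1) * Real.exp γ)) ((γ + 1 : ℕ) : ℝ)
    fun n F _ => ?_
  calc ‖S₁ n F‖ ≤ (6 * K * (n : ℝ) ^ γ + 1) ^ n * schwartzNorm (s * n) F := hbound n F
    _ ≤ Real.exp ((6 * K + 1) * Real.exp γ) * (n.factorial : ℝ) ^ (((γ + 1 : ℕ) : ℝ)) * schwartzNorm (n * s) F := by
        rw [mul_comm n s]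
        exact mul_le_mul_of_nonneg_right (linearGrowth_constant_le hK γ n) (schwartzNorm_nonneg _ _)

end Summit.QuantumFields.YangMills.Cruxes.HypercubicLimit.ConditionalMeanTelescoping

end
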